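import Summits.QuantumFields.BalabanUV.T4Continuum.Support.NE7AdmissibleFibreLHC
import Summits.QuantumFields.BalabanUV.T4Continuum.Support.NE7CritClosed
import Summits.QuantumFields.BalabanUV.T4Continuum.Support.NE7MinimiserTensionPairing
import Summits.QuantumFields.BalabanUV.T4Continuum.Support.MinimalActionExistence
import Summits.QuantumFields.BalabanUV.T4Continuum.Support.AveragingDeficitFermatAll
import Literature.MathematicalPhysics.QuantumFieldTheory.Balaban1983to89.B7BlockAvgLog
import Mathlib.Topology.Order.Compact
import HarnessLib

/-!
# NE7OpenOfMinimisation — (OPEN) OF THE CONTINUITY METHOD BY MINIMISATION: near a parameter carrying a small tangent-critical configuration, GLOBAL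
# MINIMISERS exist (compactness), stay away from the class boundary (Berge's upper hemicontinuity of the argmin over the compact class, fed by F25's
# lower hemicontinuity of the admissible fibres), and are therefore tangent-critical (Fermat) — so (OPEN) ⇐ (APE) ∧ (ALL-SMALL); the implicit-function
# continuation (IFT) of F24 LEAVES THE BILL

Cell `pub-balaban`, rung (B)+1 sub-cell t4, lineage `b2b-balaban-t4-ne7-p1`, generation 68 (CRUX PROVER NE7 #1); hunt (h12) «(OPEN) BY MINIMISATION:
IFT leaves the bill», memo `t4/b2b-balaban-t4-ne7-p1-g68/HUNT-H12-OPEN-BY-MINIMISATION.md` §1.  File F27 (over F25 `NE7AdmissibleFibreLHC`, F18 `NE7CritClosed`,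
[tree] `MinimalActionExistence` ∕ `MinimalActionCompact` (row NE3), `NE7MinimiserTensionPairing.critical_of_interior_isMinimiser` (gen 63),
`AveragingDeficitFermatAll` (row NE3-R2)).

THE ARGUMENT (§3).  Level `k+1`, class `sfClass d L N ε`, data path `γ` (continuous on `[0,1]`, unitary `N`-periodic values), radii `r₁ < r <` class radius.
At `τ₀`: `U₀` admissible, `SmallField U₀ r₁`, and ALL-SMALL: every admissible `U` with `levelAction U ≤ levelAction U₀` is `SmallField · r₁`.  Put
`m₀ = levelAction U₀`, `Bad = {U : some plaquette variable of the period window is at distance ≥ r from 1}` (closed).  (A) On the compact set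
`admissible(γ τ₀) ∩ Bad` the action is `≥ m₀ + ε′` for some `ε′ > 0` (ALL-SMALL + extreme value).  (B) The parameters `τ` carrying an admissible `U ∈ Bad` with
`levelAction U ≤ m₀ + ε′∕2` form a CLOSED set (F18's compactness lemma `isClosed_critSet_param'`) not containing `τ₀`.  (C) By F25 (LOWER HEMICONTINUITY at the
interior point `U₀`), for `τ` near `τ₀` some admissible `V_τ` has `levelAction V_τ < m₀ + ε′∕2`.  (D) Hence for `τ` near `τ₀`: the admissible set is non-empty, a
global minimiser `U_τ` EXISTS ([tree] `exists_isMinimiser_of_nonempty`), `levelAction U_τ < m₀ + ε′∕2`, so `U_τ ∉ Bad`, i.e. (periodicity) `SmallField U_τ r`;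
being interior, `U_τ` is tangent-critical by FERMAT (§1).  So the set of good parameters is open — WITHOUT an implicit function theorem, WITHOUT
non-degeneracy of the constrained Hessian, WITHOUT the smooth-preimage multiplier letter.
WHAT ([folklore]; 0 def, 0 sorry).
§1 FERMAT AT EVERY LEVEL `k+1 ≥ 1`: **`tanCritical_of_isMinimiser`** — an interior minimiser over `sfClass` is critical on the tangent space `T(U)` of the
   `(k+1)`-fold average (levels `≥ 2`: [tree] `critical_of_interior_isMinimiser` BY NAME; level `1`: `hasDerivAt_fineAction_vary_oneLevel`, Lagrange on the
   torus chart of the FIRST average via `fineCriticalAll_of_isLocalMin` with the chart-coordinate constraint `skewPR ∘ relLog`);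
§2 periodic bookkeeping: `smallField_of_window` (plaquette radius read on the period window), the window-good set is open (`isOpen_goodSet`);
§3 **`exists_minimiser_small_near`** — (A)–(D): minimisers near `τ₀` exist and are `SmallField · r`; **`open_of_ape_allSmall`** — (OPEN) in F18 ∕ F20 ∕ F24's
   exact shape at one `τ₀` from (APE at `τ₀`) ∧ (ALL-SMALL at `τ₀`); **`hopen_of_ape_allSmall`** — the `hopen` binder of F18's `critOneStep_tan_of_continuity` ∕
   F20's `oneStep_of_path_open_repW` from (APE)^path ∧ (ALL-SMALL)^path.  ALL-SMALL is F26's `allSmall_of_tanCritical_repW_gauge` (⇐ REP_w with the gauge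
   identity); (APE) is the a-priori estimate with margin ([Balaban1985Variational] Sect. F TYPE) — the ONE remaining analytic letter of the existence half
   besides REP_w.
HONEST FRAMING (page 1).  Soft topology (compactness, Berge) + the tree's submersion and Fermat; (APE) and (ALL-SMALL) are HYPOTHESES asserted for nothing;
NOT (OPEN) unconditionally, NOT ONE-STEP, NOT NE7; spine 0∕9; finite T⁴ rung (B)+1 — NOT infinite volume, NOT mass gap, NOT Clay.  Continuum YM on T⁴ ⇐
BetaPertH ∧ nine spine estimates (0/9 proved); BetaPertH ⇐ (D1) ∧ (D4) ∧ CAP+tail; G-an2-4 gates asym, D1 and NE2/3/4.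
-/

set_option autoImplicit false

open scoped BigOperators Matrix Matrix.Norms.L2Operator Topology
open NormedSpace Finset Set Filter

namespace Summit.QuantumFields.BalabanUV.T4Continuum.NE7OpenOfMinimisation

open Literature.MathematicalPhysics.QuantumFieldTheory.Balaban1983to89
open B7Prop1Explicit B7Prop2Explicit MatrixLog UnitaryModel
open T4AveragingDeficitWall (IsUnitaryCfg IsSkewDir SmallField fineAction vary blockWindow)
open AveragingDeficitResidualPairing (pushDir)
open T4AveragingDeficitWallBoundary (IsPeriodicCfg periodBox)
open AveragingDeficitPeriodicCounting (IsPeriodicDir)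
open AveragingDeficitTorusChart (TDir redN resDir chart chart_zero skewP redN_boxVec eq_wrap_add)
open AveragingDeficitChartCalculus (cavg relLog relLog_self)
open AveragingDeficitFermat (eventually_smallField_chart small512_of_liftSmall isPeriodicCfg_cavg hol_add_smul boxVec_redN_mem)
open AveragingDeficitTwoLevelPrep (skewSub mem_skewSub skewPF skewPR skewPF_of_mem smallness_of_twoLevelSmall cavg_isUnitaryCfg)
open AveragingDeficitMultiLevelPrep (tower cavgIter cpush LevelSmall TangentIter eq_of_skewPR_relLog_eq_zero)
open AveragingDeficitMultiLevelFermat (continuousAt_cavgIter_chart)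
open AveragingDeficitMultiLevelBridge (cavgIter_eq_avgIter tower_eq)
open AveragingDeficitFermatAll (FineCriticalAll fineCriticalAll_of_isLocalMin)
open MinimalActionLevels (levelAction perWin stepWt stepWt_pos blockWindow_periodBox_snd)
open MinimalActionSandwich (IsMinimiser admissible)
open MinimalActionRate (sfClass)
open MinimalActionCompact (continuous_val_hol isCompact_sfClass continuous_levelAction)
open MinimalActionExistence (isCompact_admissible exists_isMinimiser_of_nonempty)
open NE3HessForm (dAction)
open NE3HessShapes (plaqsOf)
open NE7ExactCurrent (dAction_eq_zero_of_critical)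
open NE7MinimiserTensionPairing (critical_of_interior_isMinimiser)
open NE7CritClosed (isClosed_critSet_param')
open NE7AdmissibleFibreLHC (admissible_lhc_param)

noncomputable section

variable {d : ℕ} {n : Type*} [Fintype n] [DecidableEq n]

/-! ## §1 Fermat at every level: an interior minimiser is critical on the tangent space of the constraint -/

/-- **THE LEVEL-1 FERMAT**: for `IsMinimiser d (sfClass d L N ε) L N 1 V U` (`L, N ≥ 1`) with `SmallField U a`, `0 ≤ a < ε∕L²` and `LevelSmall d L 0 (ε∕L²)`, and every
skew `(N·L)`-periodic `ψ` in the kernel of the differential of the FIRST average (`cpush L U ψ = 0`):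
`HasDerivAt (s ↦ fineAction (U e^{sψ}) (perWin d (L·N))) 0 0` — Lagrange on the torus chart of `cavg L U` with the constraint written through the chart
coordinates `skewPR ∘ relLog (cavg L U)` (strict derivative `skewPR` by `log ∘ exp = id` near `0`, onto from the `𝔲(N)` directions trivially). [folklore] -/
theorem hasDerivAt_fineAction_vary_oneLevel [Nonempty n] {L N : ℕ} [NeZero L] [NeZero N] (hL : 1 ≤ L) {ε a : ℝ}
    {V U : Site d → Fin d → (Matrix n n ℂ)ˣ} (hmin : IsMinimiser d (sfClass d L N ε) L N 1 V U) (ha0 : 0 ≤ a) (haε : a < ε / ((L : ℝ) ^ 1) ^ 2)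
    (hUa : SmallField U a) (hls : LevelSmall d L 0 (ε / ((L : ℝ) ^ 1) ^ 2)) {ψ : Site d → Fin d → Matrix n n ℂ} (hψs : IsSkewDir ψ)
    (hψP : IsPeriodicDir ψ ((N * L ^ 1 : ℕ) : ℤ)) (hψT : cpush L U ψ = 0) :
    HasDerivAt (fun s : ℝ => fineAction (vary U ψ s) (perWin d (L * N))) 0 0 := by
  set x : ℝ := ε / ((L : ℝ) ^ 1) ^ 2 with hxdef
  have hx : 0 ≤ x := ha0.trans haε.le
  obtain ⟨hUu, hUP, hUx⟩ := hmin.mem.1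
  have eP : ((N * L ^ 1 : ℕ) : ℤ) = (L : ℤ) * N := by push_cast; ring
  have hUP' : IsPeriodicCfg U ((L : ℤ) * N) := by rw [← eP]; exact hUP
  have hψP' : IsPeriodicDir ψ ((L : ℤ) * N) := by rw [← eP]; exact hψP
  have haS : LevelSmall d L 0 a := AveragingDeficitMultiLevelPrep.LevelSmall.mono ha0 haε.le hls
  obtain ⟨hliftA, -, -, -⟩ := smallness_of_twoLevelSmall (d := d) hL ha0 haS
  obtain ⟨hliftX, -, -, -⟩ := smallness_of_twoLevelSmall (d := d) hL hx hls
  have h512x := small512_of_liftSmall hL hx hliftX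
  have h512a := small512_of_liftSmall hL ha0 hliftA
  -- the base `X₀ = cavg L U`: unitary and `N`-periodic
  have hX₀u : IsUnitaryCfg (cavg L U) := cavg_isUnitaryCfg hL hUu ha0 h512a hUa
  have hX₀P : IsPeriodicCfg (cavg L U) (N : ℤ) := isPeriodicCfg_cavg L N hUP'
  haveI : CompleteSpace ↥(skewSub d n N) := FiniteDimensional.complete ℝ _
  -- the constraint through the chart coordinates of the first average: `Q W = skewPR (relLog (cavg U) W)`
  set Q : (Site d → Fin d → (Matrix n n ℂ)ˣ) → ↥(skewSub d n N) := fun W => skewPR N (relLog N (cavg L U) W) with hQdef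
  have hQ : HasStrictFDerivAt (fun Φ : TDir d n N => Q (chart (ContinuousLinearMap.id ℝ (Matrix n n ℂ)) N (cavg L U) Φ)) (skewPR N) 0 := by
    refine ((skewPR (d := d) (n := n) N).hasStrictFDerivAt (x := 0)).congr_of_eventuallyEq ?_
    have hball : Metric.ball (0 : TDir d n N) (Real.log 2) ∈ 𝓝 (0 : TDir d n N) := Metric.ball_mem_nhds _ (Real.log_pos one_lt_two)
    filter_upwards [hball] with Φ hΦ
    rw [mem_ball_zero_iff] at hΦ
    show (skewPR N) Φ = skewPR N (relLog N (cavg L U) (chart (ContinuousLinearMap.id ℝ (Matrix n n ℂ)) N (cavg L U) Φ))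
    congr 1
    funext r κ
    have hn : ‖Φ r κ‖ < Real.log 2 := lt_of_le_of_lt ((norm_le_pi_norm (Φ r) κ).trans (norm_le_pi_norm Φ r)) hΦ
    simp only [relLog, chart, AveragingDeficitTorusChart.chartDir, ContinuousLinearMap.id_apply, redN_boxVec, Units.val_mul, val_expUnit,
      ← mul_assoc, Units.inv_mul, one_mul]
    exact (B7BlockAvgLog.mlog_exp hn).symm
  have hQ' : ∀ γ : ↥(skewSub d n N), ∃ Φ : TDir d n N, (∀ r κ, Φ r κ ∈ skewAdjoint (Matrix n n ℂ)) ∧ skewPR N Φ = γ := fun γ =>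
    ⟨(γ : TDir d n N), fun r κ => γ.2 r κ, Subtype.ext (skewPF_of_mem γ.2)⟩
  -- the side condition: class radius and first averages relatively within `1∕4`
  set Near : (Site d → Fin d → (Matrix n n ℂ)ˣ) → Prop := fun W => SmallField W x ∧ ∀ (r : Fin d → Fin N) (κ : Fin d),
    ‖(((cavg L U (boxVec N r) κ)⁻¹ : (Matrix n n ℂ)ˣ) : Matrix n n ℂ) * (cavg L W (boxVec N r) κ : Matrix n n ℂ) - 1‖ ≤ 1 / 4 with hNear
  have hUPLN : IsPeriodicCfg U ((L * N : ℕ) : ℤ) := by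
    have e : ((L * N : ℕ) : ℤ) = (L : ℤ) * N := by push_cast; ring
    rw [e]; exact hUP'
  have hUPt : IsPeriodicCfg U ((L : ℤ) * (tower L N 0 : ℕ)) := hUP'
  have hNearE : ∀ᶠ θ in 𝓝 (0 : TDir d n (L * N)), Near (chart skewP (L * N) U θ) := by
    refine (eventually_smallField_chart skewP (L * N) hUPLN haε hUa).and ?_
    refine Filter.eventually_all.mpr fun r => Filter.eventually_all.mpr fun κ => ?_
    have hc0 := continuousAt_cavgIter_chart (d := d) (n := n) hL N 0 skewP hUu hUPt ha0 haS hUa (boxVec N r) κ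
    have hc : ContinuousAt (fun θ : TDir d n (L * N) =>
        ‖(((cavg L U (boxVec N r) κ)⁻¹ : (Matrix n n ℂ)ˣ) : Matrix n n ℂ)
          * ((cavgIter L 1 (chart skewP (L * N) U θ) (boxVec N r) κ : (Matrix n n ℂ)ˣ) : Matrix n n ℂ) - 1‖) 0 :=
      ((continuousAt_const.mul hc0).sub continuousAt_const).norm
    have h0 : ‖(((cavg L U (boxVec N r) κ)⁻¹ : (Matrix n n ℂ)ˣ) : Matrix n n ℂ)
        * ((cavgIter L 1 (chart skewP (L * N) U 0) (boxVec N r) κ : (Matrix n n ℂ)ˣ) : Matrix n n ℂ) - 1‖ < 1 / 4 := by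
      rw [chart_zero]
      show ‖(((cavg L U (boxVec N r) κ)⁻¹ : (Matrix n n ℂ)ˣ) : Matrix n n ℂ) * ((cavg L U (boxVec N r) κ : (Matrix n n ℂ)ˣ) : Matrix n n ℂ) - 1‖ < 1 / 4
      rw [Units.inv_mul, sub_self, norm_zero]; norm_num
    exact (hc.eventually (gt_mem_nhds h0)).mono fun θ hθ => hθ.le
  -- the honest minimality gives the chart-constrained minimality under `Near`
  have hmin' : ∀ W : Site d → Fin d → (Matrix n n ℂ)ˣ, IsUnitaryCfg W → IsPeriodicCfg W ((L : ℤ) * N) → Near W →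
      Q (cavg L W) = Q (cavg L U) → fineAction U (blockWindow L (periodBox (d := d) N)).2 ≤ fineAction W (blockWindow L (periodBox (d := d) N)).2 := by
    intro W hW hWP hWN hWQ
    obtain ⟨hWx, hWnear⟩ := hWN
    have hQ0 : skewPR N (relLog N (cavg L U) (cavg L W)) = 0 := by
      have h : Q (cavg L W) = Q (cavg L U) := hWQ
      simp only [hQdef, relLog_self, map_zero] at h
      exact h
    have hWXu : IsUnitaryCfg (cavg L W) := cavg_isUnitaryCfg hL hW hx h512x hWx
    have hWXP : IsPeriodicCfg (cavg L W) (N : ℤ) := isPeriodicCfg_cavg L N hWP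
    have heq : cavg L W = cavg L U := eq_of_skewPR_relLog_eq_zero hX₀P hWXP hX₀u hWXu hWnear hQ0
    have hWP' : IsPeriodicCfg W ((N * L ^ 1 : ℕ) : ℤ) := by rw [eP]; exact hWP
    have hadm : W ∈ admissible (sfClass d L N ε) L 1 V := by
      refine ⟨⟨hW, hWP', hWx⟩, ?_⟩
      have h := hmin.mem.2
      rw [← cavgIter_eq_avgIter] at h ⊢
      show cavg L W = V
      rw [heq]; exact h
    have hle := hmin.le W hadm
    unfold levelAction at hle
    have hw : 0 < ((stepWt d L)⁻¹) ^ 1 := pow_pos (inv_pos.mpr (stepWt_pos (d := d) L hL)) _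
    have e : N * L ^ 1 = L * N := by ring
    rw [e] at hle
    rw [blockWindow_periodBox_snd L _ hL]
    exact le_of_mul_le_mul_left hle hw
  have hcrit : FineCriticalAll L N U (fun φ => skewPR N (resDir N φ) = 0) :=
    fineCriticalAll_of_isLocalMin (M := N) hUu hUP' ha0 hliftA hUa Q (skewPR N) hQ hQ' Near hNearE hmin'
  have hTc : skewPR N (resDir N fun y κ => pushDir L U ψ ((L : ℤ) • y) κ) = 0 := by
    have h0 : (fun y κ => pushDir L U ψ ((L : ℤ) • y) κ) = cpush L U ψ := rfl
    rw [h0, hψT]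
    have h1 : resDir N (0 : Site d → Fin d → Matrix n n ℂ) = 0 := by funext r κ; rfl
    rw [h1, map_zero]
  have h := hcrit ψ hψs hψP' hTc
  rw [blockWindow_periodBox_snd L _ hL] at h
  exact h

/-- **FERMAT AT EVERY LEVEL, IN THE TANGENT CURRENCY OF F18 ∕ F19**: an `IsMinimiser d (sfClass d L N ε) L N (k+1) V U` (`L, N ≥ 1`) with `SmallField U a`,
`0 ≤ a < ε(L^{k+1})^{−2}` (INTERIOR) and `LevelSmall d L k (ε(L^{k+1})^{−2})` is critical on `T(U) = {φ skew periodic : TangentIter L k U φ}`: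
`dAction U φ (perWin) = 0` (level `1`: §1; levels `≥ 2`: [tree] `NE7MinimiserTensionPairing.critical_of_interior_isMinimiser`). [folklore] -/
theorem tanCritical_of_isMinimiser [Nonempty n] {L N k : ℕ} [NeZero L] [NeZero N] (hL : 1 ≤ L) (hN : 1 ≤ N) {ε a : ℝ}
    {V U : Site d → Fin d → (Matrix n n ℂ)ˣ} (hmin : IsMinimiser d (sfClass d L N ε) L N (k + 1) V U) (ha0 : 0 ≤ a)
    (haε : a < ε / ((L : ℝ) ^ (k + 1)) ^ 2) (hUa : SmallField U a) (hls : LevelSmall d L k (ε / ((L : ℝ) ^ (k + 1)) ^ 2)) :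
    ∀ φ : Site d → Fin d → Matrix n n ℂ, IsSkewDir φ → IsPeriodicDir φ ((N * L ^ (k + 1) : ℕ) : ℤ) → TangentIter L k U φ →
      dAction U φ (perWin d (N * L ^ (k + 1))) = 0 := by
  intro φ hφs hφP hφT
  cases k with
  | zero =>
      have hT : cpush L U φ = 0 := hφT
      have h := hasDerivAt_fineAction_vary_oneLevel hL hmin ha0 haε hUa hls hφs hφP hT
      have e : N * L ^ (0 + 1) = L * N := by ring
      rw [e]
      exact dAction_eq_zero_of_critical h
  | succ j =>
      have hT : TangentIter L j (cavg L U) (cpush L U φ) := hφT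
      have h := critical_of_interior_isMinimiser hL hN j hmin ha0 haε hUa hls hφs hφP hT
      exact dAction_eq_zero_of_critical h

/-! ## §2 Periodic bookkeeping: the plaquette radius on the period window; the window-good set is open -/

/-- **The plaquette radius of a periodic configuration is read on the period window**: `U` `P`-periodic (`P ≥ 1`) with
`‖U(∂p) − 1‖ ≤ r` for the plaquettes based in `periodBox P` ⟹ `SmallField U r`. [folklore] -/
theorem smallField_of_window {P : ℕ} [NeZero P] {U : Site d → Fin d → (Matrix n n ℂ)ˣ} (hUP : IsPeriodicCfg U (P : ℤ)) {r : ℝ}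
    (h : ∀ x ∈ periodBox (d := d) P, ∀ κ κ' : Fin d, κ ≠ κ' → ‖((hol U x (plaqWord κ κ') : (Matrix n n ℂ)ˣ) : Matrix n n ℂ) - 1‖ ≤ r) :
    SmallField U r := by
  intro x κ κ' hκ
  have hx := eq_wrap_add P x
  have hper : hol U x (plaqWord κ κ') = hol U (boxVec P (redN P x)) (plaqWord κ κ') := by
    conv_lhs => rw [hx]
    exact hol_add_smul hUP _ _ _
  rw [hper]
  exact h _ (boxVec_redN_mem P x) κ κ' hκ

/-- **The window-good set `{U : ‖U(∂p) − 1‖ < r on the period window}` is open** (finitely many continuous plaquette variables). [folklore] -/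
theorem isOpen_goodSet (P : ℕ) (r : ℝ) :
    IsOpen {U : Site d → Fin d → (Matrix n n ℂ)ˣ | ∀ x ∈ periodBox (d := d) P, ∀ κ κ' : Fin d, κ ≠ κ' →
      ‖((hol U x (plaqWord κ κ') : (Matrix n n ℂ)ˣ) : Matrix n n ℂ) - 1‖ < r} := by
  have h : {U : Site d → Fin d → (Matrix n n ℂ)ˣ | ∀ x ∈ periodBox (d := d) P, ∀ κ κ' : Fin d, κ ≠ κ' →
      ‖((hol U x (plaqWord κ κ') : (Matrix n n ℂ)ˣ) : Matrix n n ℂ) - 1‖ < r}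
      = ⋂ x ∈ periodBox (d := d) P, ⋂ κ : Fin d, ⋂ κ' : Fin d, {U | κ ≠ κ' → ‖((hol U x (plaqWord κ κ') : (Matrix n n ℂ)ˣ) : Matrix n n ℂ) - 1‖ < r} := by
    ext U; simp only [mem_setOf_eq, mem_iInter]
  rw [h]
  refine isOpen_biInter_finset fun x _ => isOpen_iInter_of_finite fun κ => isOpen_iInter_of_finite fun κ' => ?_
  by_cases hκ : κ = κ'
  · have : {U : Site d → Fin d → (Matrix n n ℂ)ˣ | κ ≠ κ' → ‖((hol U x (plaqWord κ κ') : (Matrix n n ℂ)ˣ) : Matrix n n ℂ) - 1‖ < r} = univ := by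
      ext U; simp [hκ]
    rw [this]; exact isOpen_univ
  · have : {U : Site d → Fin d → (Matrix n n ℂ)ˣ | κ ≠ κ' → ‖((hol U x (plaqWord κ κ') : (Matrix n n ℂ)ˣ) : Matrix n n ℂ) - 1‖ < r}
        = {U | ‖((hol U x (plaqWord κ κ') : (Matrix n n ℂ)ˣ) : Matrix n n ℂ) - 1‖ < r} := by
      ext U; simp [hκ]
    rw [this]
    exact isOpen_lt ((continuous_val_hol x _).sub continuous_const).norm continuous_const

/-! ## §3 (OPEN) by minimisation -/

/-- **MINIMISERS NEAR `τ₀` EXIST AND ARE SMALL** (steps (A)–(D) of the module docstring).  Level `k+1` of `sfClass d L N ε` (`L ≥ 2`, `N ≥ 1`, `16C₀ε ≤ 3`,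
`1024(d+1)(d+4)L²ε ≤ 1`, `LevelSmall d L k (ε(L^{k+1})^{−2})`); `γ` continuous on `[0,1]` with unitary `N`-periodic values; radii `r₁ < r`; at `τ₀ ∈ [0,1]`:
`U₀ ∈ admissible … (γ τ₀)` with `SmallField U₀ r₁`, `r₁ < ε(L^{k+1})^{−2}`, and ALL-SMALL (every admissible `U` with `levelAction U ≤ levelAction U₀` is
`SmallField · r₁`).  THEN `∃ ρ > 0`, for `τ ∈ [0,1]`, `|τ − τ₀| < ρ`: a global minimiser at the datum `γ τ` exists and every such minimiser is `SmallField · r`.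
[folklore] -/
theorem exists_minimiser_small_near [Nonempty n] {L N k : ℕ} [NeZero L] [NeZero N] (hL : 2 ≤ L) {ε r r₁ : ℝ} (hε0 : 0 ≤ ε)
    (hε1 : 16 * C0 d * ε ≤ 3) (hε2 : 1024 * (d + 1) * (d + 4) * (L : ℝ) ^ 2 * ε ≤ 1) (hls : LevelSmall d L k (ε / ((L : ℝ) ^ (k + 1)) ^ 2))
    (hr₁r : r₁ < r) (hr₁ε : r₁ < ε / ((L : ℝ) ^ (k + 1)) ^ 2)
    (γ : ℝ → (Site d → Fin d → (Matrix n n ℂ)ˣ)) (hγ : ContinuousOn γ (Icc (0 : ℝ) 1)) (hγu : ∀ τ ∈ Icc (0 : ℝ) 1, IsUnitaryCfg (γ τ))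
    (hγP : ∀ τ ∈ Icc (0 : ℝ) 1, IsPeriodicCfg (γ τ) (N : ℤ)) {τ₀ : ℝ} (hτ₀ : τ₀ ∈ Icc (0 : ℝ) 1)
    {U₀ : Site d → Fin d → (Matrix n n ℂ)ˣ} (hU₀ : U₀ ∈ admissible (sfClass d L N ε) L (k + 1) (γ τ₀)) (hU₀r₁ : SmallField U₀ r₁)
    (hall : ∀ U ∈ admissible (sfClass d L N ε) L (k + 1) (γ τ₀), levelAction d L N (k + 1) U ≤ levelAction d L N (k + 1) U₀ → SmallField U r₁) :
    ∃ ρ : ℝ, 0 < ρ ∧ ∀ τ ∈ Icc (0 : ℝ) 1, |τ - τ₀| < ρ →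
      (∃ U, IsMinimiser d (sfClass d L N ε) L N (k + 1) (γ τ) U) ∧
      ∀ U, IsMinimiser d (sfClass d L N ε) L N (k + 1) (γ τ) U → SmallField U r := by
  have hL1 : 1 ≤ L := by omega
  set Pd : ℕ := N * L ^ (k + 1) with hPd
  haveI : NeZero Pd := ⟨Nat.mul_ne_zero (NeZero.ne N) (pow_ne_zero _ (NeZero.ne L))⟩
  set f : (Site d → Fin d → (Matrix n n ℂ)ˣ) → ℝ := fun U => levelAction d L N (k + 1) U with hfdef
  have hfc : Continuous f := continuous_levelAction (d := d) (n := n) L N (k + 1)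
  set m₀ : ℝ := f U₀ with hm₀
  -- the window-good set and its complement
  set Good : Set (Site d → Fin d → (Matrix n n ℂ)ˣ) := {U | ∀ x ∈ periodBox (d := d) Pd, ∀ κ κ' : Fin d, κ ≠ κ' →
    ‖((hol U x (plaqWord κ κ') : (Matrix n n ℂ)ˣ) : Matrix n n ℂ) - 1‖ < r} with hGood
  have hGoodo : IsOpen Good := isOpen_goodSet (d := d) (n := n) Pd r
  have hBadc : IsClosed Goodᶜ := hGoodo.isClosed_compl
  -- a good class member is `SmallField · r`; a bad one is not `SmallField · r₁`
  have hgood_small : ∀ U ∈ sfClass d L N ε (k + 1), U ∈ Good → SmallField U r := by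
    intro U hU hUg
    exact smallField_of_window (P := Pd) hU.2.1 fun x hx κ κ' hκ => (hUg x hx κ κ' hκ).le
  have hbad_not : ∀ U : Site d → Fin d → (Matrix n n ℂ)ˣ, U ∉ Good → ¬ SmallField U r₁ := by
    intro U hUb hUr₁
    apply hUb
    intro x hx κ κ' hκ
    exact lt_of_le_of_lt (hUr₁ x κ κ' hκ) hr₁r
  -- (A) the gap on the bad part of the fibre at `τ₀`
  have hgap : ∃ ε' : ℝ, 0 < ε' ∧ ∀ U ∈ admissible (sfClass d L N ε) L (k + 1) (γ τ₀), U ∉ Good → m₀ + ε' ≤ f U := by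
    set G : Set (Site d → Fin d → (Matrix n n ℂ)ˣ) := admissible (sfClass d L N ε) L (k + 1) (γ τ₀) ∩ Goodᶜ with hG
    have hGc : IsCompact G := (isCompact_admissible hL hε0 hε1 hε2 N (k + 1) (γ τ₀)).inter_right hBadc
    have hpos : ∀ U ∈ G, m₀ < f U := by
      intro U hU
      by_contra hle
      exact hbad_not U hU.2 (hall U hU.1 (not_lt.mp hle))
    rcases G.eq_empty_or_nonempty with hGe | hGne
    · refine ⟨1, one_pos, fun U hU hUb => ?_⟩
      have : U ∈ G := ⟨hU, hUb⟩
      rw [hGe] at this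
      exact absurd this (Set.notMem_empty U)
    · obtain ⟨U₁, hU₁G, hU₁min⟩ := hGc.exists_isMinOn hGne hfc.continuousOn
      refine ⟨f U₁ - m₀, by linarith [hpos U₁ hU₁G], fun U hU hUb => ?_⟩
      have h := hU₁min (show U ∈ G from ⟨hU, hUb⟩)
      simp only [mem_setOf_eq] at h
      linarith
  obtain ⟨ε', hε', hgap'⟩ := hgap
  -- (B) the parameters carrying a cheap bad admissible configuration form a closed set avoiding `τ₀`
  set T : Set ℝ := {τ : ℝ | τ ∈ Icc (0 : ℝ) 1 ∧ ∃ U : Site d → Fin d → (Matrix n n ℂ)ˣ,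
    U ∈ admissible (sfClass d L N ε) L (k + 1) (γ τ) ∧ SmallField U (ε / ((L : ℝ) ^ (k + 1)) ^ 2) ∧ (U ∈ Goodᶜ ∧ f U ≤ m₀ + ε' / 2)} with hT
  have hTcl : IsClosed T := by
    have hcc : IsClosed {U : Site d → Fin d → (Matrix n n ℂ)ˣ | U ∈ sfClass d L N ε (k + 1) ∧ (U ∈ Goodᶜ ∧ f U ≤ m₀ + ε' / 2)} := by
      have e : {U : Site d → Fin d → (Matrix n n ℂ)ˣ | U ∈ sfClass d L N ε (k + 1) ∧ (U ∈ Goodᶜ ∧ f U ≤ m₀ + ε' / 2)}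
          = sfClass d L N ε (k + 1) ∩ (Goodᶜ ∩ {U | f U ≤ m₀ + ε' / 2}) := by ext U; simp only [mem_setOf_eq, mem_inter_iff]
      rw [e]
      exact (isCompact_sfClass (d := d) (n := n) L N ε (k + 1)).isClosed.inter (hBadc.inter (isClosed_le hfc continuous_const))
    rw [hT]
    exact isClosed_critSet_param' hL hε0 hε1 hε2 γ hγ (fun U => U ∈ Goodᶜ ∧ f U ≤ m₀ + ε' / 2) hcc
  have hτ₀T : τ₀ ∉ T := by
    rintro ⟨-, U, hU, -, hUb, hUf⟩
    have h := hgap' U hU hUb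
    linarith
  obtain ⟨ρ₁, hρ₁, hball₁⟩ : ∃ ρ₁ > 0, Metric.ball τ₀ ρ₁ ⊆ Tᶜ := Metric.mem_nhds_iff.mp (hTcl.isOpen_compl.mem_nhds hτ₀T)
  -- (C) lower hemicontinuity at the interior point `U₀`: cheap admissible configurations nearby
  have h𝒰 : {U : Site d → Fin d → (Matrix n n ℂ)ˣ | f U < m₀ + ε' / 2} ∈ 𝓝 U₀ :=
    (isOpen_lt hfc continuous_const).mem_nhds (by show f U₀ < m₀ + ε' / 2; rw [hm₀]; linarith)
  have hlhc := admissible_lhc_param (N := N) (k := k) hL1 hε0 hls (hγ.continuousWithinAt hτ₀) hγu hγP hU₀ hr₁ε hU₀r₁ h𝒰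
  obtain ⟨ρ₂, hρ₂, hball₂⟩ := Metric.mem_nhdsWithin_iff.mp hlhc
  -- (D) assemble
  refine ⟨min ρ₁ ρ₂, lt_min hρ₁ hρ₂, fun τ hτI hτρ => ?_⟩
  have hτ1 : τ ∈ Metric.ball τ₀ ρ₁ := by rw [Metric.mem_ball, Real.dist_eq]; exact lt_of_lt_of_le hτρ (min_le_left _ _)
  have hτ2 : τ ∈ Metric.ball τ₀ ρ₂ := by rw [Metric.mem_ball, Real.dist_eq]; exact lt_of_lt_of_le hτρ (min_le_right _ _)
  obtain ⟨V₁, hV₁f, hV₁adm⟩ := hball₂ ⟨hτ2, hτI⟩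
  have hne : (admissible (sfClass d L N ε) L (k + 1) (γ τ)).Nonempty := ⟨V₁, hV₁adm⟩
  have hex := exists_isMinimiser_of_nonempty hL hε0 hε1 hε2 hne
  refine ⟨hex, fun U hU => ?_⟩
  have hUf : f U ≤ m₀ + ε' / 2 := (hU.le V₁ hV₁adm).trans (le_of_lt hV₁f)
  have hτT : τ ∉ T := hball₁ hτ1
  have hUgood : U ∈ Good := by
    by_contra hUb
    exact hτT ⟨hτI, U, hU.mem, hU.mem.1.2.2, hUb, hUf⟩
  exact hgood_small U hU.mem.1 hUgood

/-- **(OPEN) AT ONE PARAMETER FROM (APE) ∧ (ALL-SMALL) AT THAT PARAMETER** — the relatively-open half of the continuity method in F18 ∕ F20 ∕ F24's exact shape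
(radius `r` KEPT, tangent criticality), by minimisation: the hypotheses of `exists_minimiser_small_near` with `r < ε(L^{k+1})^{−2}`, where the small
configuration `U₀` at `τ₀` is obtained from a `SmallField · r` tangent-critical admissible one by (APE) (`⟹ SmallField · r₁`) and ALL-SMALL is asked of it;
the produced configurations are the global minimisers, tangent-critical by §1. [folklore] -/
theorem open_of_ape_allSmall [Nonempty n] {L N k : ℕ} [NeZero L] [NeZero N] (hL : 2 ≤ L) (hN : 1 ≤ N) {ε r r₁ : ℝ} (hε0 : 0 ≤ ε)
    (hε1 : 16 * C0 d * ε ≤ 3) (hε2 : 1024 * (d + 1) * (d + 4) * (L : ℝ) ^ 2 * ε ≤ 1) (hls : LevelSmall d L k (ε / ((L : ℝ) ^ (k + 1)) ^ 2))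
    (hr₁ : 0 ≤ r₁) (hr₁r : r₁ < r) (hrε : r < ε / ((L : ℝ) ^ (k + 1)) ^ 2)
    (γ : ℝ → (Site d → Fin d → (Matrix n n ℂ)ˣ)) (hγ : ContinuousOn γ (Icc (0 : ℝ) 1)) (hγu : ∀ τ ∈ Icc (0 : ℝ) 1, IsUnitaryCfg (γ τ))
    (hγP : ∀ τ ∈ Icc (0 : ℝ) 1, IsPeriodicCfg (γ τ) (N : ℤ)) {τ₀ : ℝ} (hτ₀ : τ₀ ∈ Icc (0 : ℝ) 1)
    (hape : ∀ U ∈ admissible (sfClass d L N ε) L (k + 1) (γ τ₀), SmallField U r →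
      (∀ φ : Site d → Fin d → Matrix n n ℂ, IsSkewDir φ → IsPeriodicDir φ ((N * L ^ (k + 1) : ℕ) : ℤ) → TangentIter L k U φ →
        dAction U φ (perWin d (N * L ^ (k + 1))) = 0) → SmallField U r₁)
    (hall : ∀ U₀ ∈ admissible (sfClass d L N ε) L (k + 1) (γ τ₀), SmallField U₀ r₁ →
      (∀ φ : Site d → Fin d → Matrix n n ℂ, IsSkewDir φ → IsPeriodicDir φ ((N * L ^ (k + 1) : ℕ) : ℤ) → TangentIter L k U₀ φ →
        dAction U₀ φ (perWin d (N * L ^ (k + 1))) = 0) →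
      ∀ U ∈ admissible (sfClass d L N ε) L (k + 1) (γ τ₀), levelAction d L N (k + 1) U ≤ levelAction d L N (k + 1) U₀ → SmallField U r₁)
    (h0 : ∃ U : Site d → Fin d → (Matrix n n ℂ)ˣ, U ∈ admissible (sfClass d L N ε) L (k + 1) (γ τ₀) ∧ SmallField U r ∧
      ∀ φ : Site d → Fin d → Matrix n n ℂ, IsSkewDir φ → IsPeriodicDir φ ((N * L ^ (k + 1) : ℕ) : ℤ) → TangentIter L k U φ →
        dAction U φ (perWin d (N * L ^ (k + 1))) = 0) :
    ∃ ρ : ℝ, 0 < ρ ∧ ∀ τ ∈ Icc (0 : ℝ) 1, |τ - τ₀| < ρ →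
      ∃ U : Site d → Fin d → (Matrix n n ℂ)ˣ, U ∈ admissible (sfClass d L N ε) L (k + 1) (γ τ) ∧ SmallField U r ∧
        ∀ φ : Site d → Fin d → Matrix n n ℂ, IsSkewDir φ → IsPeriodicDir φ ((N * L ^ (k + 1) : ℕ) : ℤ) → TangentIter L k U φ →
          dAction U φ (perWin d (N * L ^ (k + 1))) = 0 := by
  have hL1 : 1 ≤ L := by omega
  obtain ⟨U₀, hU₀, hU₀r, hU₀crit⟩ := h0
  have hU₀r₁ : SmallField U₀ r₁ := hape U₀ hU₀ hU₀r hU₀crit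
  have hr₁ε : r₁ < ε / ((L : ℝ) ^ (k + 1)) ^ 2 := hr₁r.trans hrε
  obtain ⟨ρ, hρ, hnear⟩ := exists_minimiser_small_near hL hε0 hε1 hε2 hls hr₁r hr₁ε γ hγ hγu hγP hτ₀ hU₀ hU₀r₁ (hall U₀ hU₀ hU₀r₁ hU₀crit)
  refine ⟨ρ, hρ, fun τ hτI hτρ => ?_⟩
  obtain ⟨⟨U, hU⟩, hsmall⟩ := hnear τ hτI hτρ
  have hUr : SmallField U r := hsmall U hU
  exact ⟨U, hU.mem, hUr, tanCritical_of_isMinimiser hL1 hN hU (hr₁.trans hr₁r.le) hrε hUr hls⟩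

/-- **THE `hopen` BINDER OF F18's `critOneStep_tan_of_continuity` ∕ F20's `oneStep_of_path_open_repW` FROM (APE)^path ∧ (ALL-SMALL)^path** (both quantified
over the data path; ALL-SMALL is F26's `allSmall_of_tanCritical_repW_gauge` ⇐ REP_w with the gauge identity). [folklore] -/
theorem hopen_of_ape_allSmall [Nonempty n] {L N k : ℕ} [NeZero L] [NeZero N] (hL : 2 ≤ L) (hN : 1 ≤ N) {ε r r₁ : ℝ} (hε0 : 0 ≤ ε)
    (hε1 : 16 * C0 d * ε ≤ 3) (hε2 : 1024 * (d + 1) * (d + 4) * (L : ℝ) ^ 2 * ε ≤ 1) (hls : LevelSmall d L k (ε / ((L : ℝ) ^ (k + 1)) ^ 2))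
    (hr₁ : 0 ≤ r₁) (hr₁r : r₁ < r) (hrε : r < ε / ((L : ℝ) ^ (k + 1)) ^ 2)
    (γ : ℝ → (Site d → Fin d → (Matrix n n ℂ)ˣ)) (hγ : ContinuousOn γ (Icc (0 : ℝ) 1)) (hγu : ∀ τ ∈ Icc (0 : ℝ) 1, IsUnitaryCfg (γ τ))
    (hγP : ∀ τ ∈ Icc (0 : ℝ) 1, IsPeriodicCfg (γ τ) (N : ℤ))
    (hape : ∀ τ ∈ Icc (0 : ℝ) 1, ∀ U ∈ admissible (sfClass d L N ε) L (k + 1) (γ τ), SmallField U r →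
      (∀ φ : Site d → Fin d → Matrix n n ℂ, IsSkewDir φ → IsPeriodicDir φ ((N * L ^ (k + 1) : ℕ) : ℤ) → TangentIter L k U φ →
        dAction U φ (perWin d (N * L ^ (k + 1))) = 0) → SmallField U r₁)
    (hall : ∀ τ ∈ Icc (0 : ℝ) 1, ∀ U₀ ∈ admissible (sfClass d L N ε) L (k + 1) (γ τ), SmallField U₀ r₁ →
      (∀ φ : Site d → Fin d → Matrix n n ℂ, IsSkewDir φ → IsPeriodicDir φ ((N * L ^ (k + 1) : ℕ) : ℤ) → TangentIter L k U₀ φ →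
        dAction U₀ φ (perWin d (N * L ^ (k + 1))) = 0) →
      ∀ U ∈ admissible (sfClass d L N ε) L (k + 1) (γ τ), levelAction d L N (k + 1) U ≤ levelAction d L N (k + 1) U₀ → SmallField U r₁) :
    ∀ τ₀ ∈ Icc (0 : ℝ) 1,
      (∃ U : Site d → Fin d → (Matrix n n ℂ)ˣ, U ∈ admissible (sfClass d L N ε) L (k + 1) (γ τ₀) ∧ SmallField U r ∧
        ∀ φ : Site d → Fin d → Matrix n n ℂ, IsSkewDir φ → IsPeriodicDir φ ((N * L ^ (k + 1) : ℕ) : ℤ) → TangentIter L k U φ →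
          dAction U φ (perWin d (N * L ^ (k + 1))) = 0) →
      ∃ ρ : ℝ, 0 < ρ ∧ ∀ τ ∈ Icc (0 : ℝ) 1, |τ - τ₀| < ρ →
        ∃ U : Site d → Fin d → (Matrix n n ℂ)ˣ, U ∈ admissible (sfClass d L N ε) L (k + 1) (γ τ) ∧ SmallField U r ∧
          ∀ φ : Site d → Fin d → Matrix n n ℂ, IsSkewDir φ → IsPeriodicDir φ ((N * L ^ (k + 1) : ℕ) : ℤ) → TangentIter L k U φ →
            dAction U φ (perWin d (N * L ^ (k + 1))) = 0 :=
  fun τ₀ hτ₀ h0 => open_of_ape_allSmall hL hN hε0 hε1 hε2 hls hr₁ hr₁r hrε γ hγ hγu hγP hτ₀ (hape τ₀ hτ₀) (hall τ₀ hτ₀) h0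

end

end Summit.QuantumFields.BalabanUV.T4Continuum.NE7OpenOfMinimisation
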